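import Summits.Ventures.QEC.Census.BB.A1s_n192_k4_0fa3ae82.Words
import Summits.Ventures.QEC.Census.BB.A1s_n192_k4_0fa3ae82.Q96Low
import HarnessLib

set_option Elab.async false

/-!
# `[[192,4,18]]` one-level cover certificate — `Q96Low` on qec-type-10's words (bridge)
(qec-search-9 g5; lead block 149 (1).) qec-type-10's `Words.lean` names the tower quotient's check rows `hx1` / `hz1` (as
`maskOf` supports); `Q96Defs`/`Q96Low` (search-9) name the same rows `q96HX` / `q96HZ` (as numerals, `tower[0]` of the JSON).
The two literals are equal (decided here), so the quotient's flat `Z`-distance bound `q96_low8` reads verbatim on `hx1`/`hz1`: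
`q96_low8'` = the `hlow` hypothesis of `CertCoverProducers.noBadOver_zero_of_quotient` with `Wq = 8` (`16 < 2·9`), i.e.
`hzero : NoBadOver cov hx hz 16 0 := noBadOver_zero_of_quotient hc hcr hrowsX hpullZ (by norm_num) q96_low8'` once the cover /
row tables are decided (type-10 `Core`). Theorems only; KERNEL; axioms standard.
-/

namespace Summit.Ventures.QEC.Census.A1s_n192_k4_0fa3ae82

open Matrix Summit.Ventures.QEC.Census Literature.InformationTheory.QuantumCodes

/-- type-10's `hx1` (supports) is search-9's `q96HX` (numerals): the same 48 words. -/
theorem hx1_eq_q96HX : hx1 = q96HX := by decide +kernel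

/-- type-10's `hz1` is search-9's `q96HZ`. -/
theorem hz1_eq_q96HZ : hz1 = q96HZ := by decide +kernel

/-- **`q96_low8'`** — the tower quotient `QC(1 + y + y⁸, x + y¹⁷ + y²²)` on `ℤ₂ × ℤ₂₄` has flat `Z`-distance `> 8`, stated on
qec-type-10's words: every `y < 2^96` with `H^X₉₆ y = 0` outside `rowspace H^Z₉₆` has weight `> 8`. -/
theorem q96_low8' : ∀ y : ℕ, y < 2 ^ 96 → synZero 96 hx1 y = true →
    ofBits 96 y ∉ rowSpace (rowMatrix 96 hz1) → 8 < popc 96 y := by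
  rw [hx1_eq_q96HX, hz1_eq_q96HZ]
  exact q96_low8

end Summit.Ventures.QEC.Census.A1s_n192_k4_0fa3ae82
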